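import Summits.AtomisticToContinuum.Crystallization.Theorems.ExcessDecayLiouvillePhononStabilityCertFrame

/-!
# Near-certificate layer I: two-point tables

Support file for crux `PhononStability` (line `contragredient-window-collapse`): covariant coordinates of label
fields, two-point tables `Σ_k uᵀ M v` indexed by a bond class and a rational 3×3 matrix, their canonical form
(orientation + merging, an exact identity of evaluations on finitely supported fields), and the pair form of a
class as a table. Everything here is bookkeeping for the certificate check of the near range. [folklore]
-/

noncomputable section

open scoped BigOperators Classical InnerProductSpace
open Filter Set Function
open Summit.AtomisticToContinuum.Crystallization.Theorems.PhononStabilityNegative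

namespace Summit.AtomisticToContinuum.Crystallization.Theorems.PhononStabilityCWC.Cert

local notation "E3" => EuclideanSpace ℝ (Fin 3)

/-- 3×3 rational matrices as functions. -/
abbrev Mat := Fin 3 → Fin 3 → ℚ
/-- Covariant coordinates of a label field. -/
def cov (w : Label → E3) (ℓ : Label) : Fin 3 → ℝ := covOf (w ℓ)
/-- Covariant difference across a bond. -/
def covDiff (c : BondClass) (w : Label → E3) (k : Fin 3 → ℤ) : Fin 3 → ℝ := covOf (bondDiff c w k)
/-- Real bilinear form of a rational matrix. -/
def bil (M : Mat) (x y : Fin 3 → ℝ) : ℝ := ∑ i, ∑ j, (M i j : ℝ) * x i * y j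
/-- Two-point table. -/
abbrev TPTable := List (BondClass × Mat)
/-- Evaluation of one two-point entry. -/
def tpEntry (w : Label → E3) (e : BondClass × Mat) : ℝ :=
  ∑' k : Fin 3 → ℤ, bil e.2 (cov w (e.1.1, k)) (cov w (e.1.2.1, k + e.1.2.2))
/-- Evaluation of a two-point table. -/
def tpEval (T : TPTable) (w : Label → E3) : ℝ := (T.map (tpEntry w)).sum
/-- Pair table of a class. -/
def pairTable (c : BondClass) (M : Mat) : TPTable :=
  [((c.1, c.1, 0), M), ((c.2.1, c.2.1, 0), M), ((c.1, c.2.1, c.2.2), fun i j => -M i j),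
    ((c.2.1, c.1, -c.2.2), fun i j => -M i j)]
/-- Pair form in covariant coordinates. -/
def pairEval (c : BondClass) (M : Mat) (w : Label → E3) : ℝ := ∑' k, bil M (covDiff c w k) (covDiff c w k)
/-- Reversed entry. -/
def flipEntry (e : BondClass × Mat) : BondClass × Mat := ((e.1.2.1, e.1.1, -e.1.2.2), fun i j => e.2 j i)
/-- Key order. -/
def keyLE (a b : BondClass) : Bool :=
  (a.1.val, a.2.1.val, a.2.2 0, a.2.2 1, a.2.2 2) ≤ (b.1.val, b.2.1.val, b.2.2 0, b.2.2 1, b.2.2 2)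
/-- Orient an entry canonically. -/
def orient (e : BondClass × Mat) : BondClass × Mat := if keyLE (flipEntry e).1 e.1 then e else flipEntry e
/-- materialise a matrix closure into its nine entries (semantically the identity; avoids re-evaluating sums). -/
def mat9 (Q : Mat) : Mat :=
  let a00 := Q 0 0; let a01 := Q 0 1; let a02 := Q 0 2
  let a10 := Q 1 0; let a11 := Q 1 1; let a12 := Q 1 2
  let a20 := Q 2 0; let a21 := Q 2 1; let a22 := Q 2 2
  fun i j => match i, j with
    | 0, 0 => a00 | 0, 1 => a01 | 0, 2 => a02
    | 1, 0 => a10 | 1, 1 => a11 | 1, 2 => a12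
    | 2, 0 => a20 | 2, 1 => a21 | 2, 2 => a22
/-- Merge adjacent entries with equal class (the input is meant to be sorted by class). -/
def mergeAdj : TPTable → TPTable
  | [] => []
  | [e] => [e]
  | e :: f :: rest =>
      if e.1 = f.1 then mergeAdj ((e.1, mat9 fun i j => e.2 i j + f.2 i j) :: rest) else e :: mergeAdj (f :: rest)
  termination_by T => T.length
/-- Canonical form: orient every entry, sort by class, merge equal classes (`O(n log n)`). -/
def canon (T : TPTable) : TPTable := mergeAdj ((T.map orient).mergeSort fun a b => keyLE a.1 b.1)
-- ===== end copy =====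

/-! ## bil algebra -/

/-- additivity of `bil` in the matrix. [folklore] -/
theorem bil_add_left (M N : Mat) (x y : Fin 3 → ℝ) :
    bil (fun i j => M i j + N i j) x y = bil M x y + bil N x y := by
  simp only [bil, Rat.cast_add, add_mul, Finset.sum_add_distrib]

/-- `bil` of the negated matrix. [folklore] -/
theorem bil_neg (M : Mat) (x y : Fin 3 → ℝ) : bil (fun i j => -M i j) x y = -bil M x y := by
  simp only [bil, Rat.cast_neg, neg_mul, Finset.sum_neg_distrib]

/-- `bil` of the transposed matrix swaps the arguments. [folklore] -/
theorem bil_transpose (M : Mat) (x y : Fin 3 → ℝ) : bil (fun i j => M j i) x y = bil M y x := by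
  simp only [bil]
  rw [Finset.sum_comm]
  refine Finset.sum_congr rfl fun i _ => Finset.sum_congr rfl fun j _ => ?_
  ring

/-- expansion of `bil M (x − y) (x − y)`. [folklore] -/
theorem bil_sub_sub (M : Mat) (x y : Fin 3 → ℝ) :
    bil M (y - x) (y - x) = bil M x x + bil M y y - bil M x y - bil M y x := by
  simp only [bil, Pi.sub_apply]
  have : ∀ i j, (M i j : ℝ) * (y i - x i) * (y j - x j) =
      (M i j : ℝ) * x i * x j + (M i j : ℝ) * y i * y j - (M i j : ℝ) * x i * y j - (M i j : ℝ) * y i * x j := by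
    intro i j; ring
  simp only [this, Finset.sum_add_distrib, Finset.sum_sub_distrib]

/-! ## covariant coordinates are linear -/

/-- covariant coordinates are additive. [folklore] -/
theorem covOf_sub (x y : E3) : covOf (x - y) = covOf x - covOf y := by
  funext i; simp [covOf, inner_sub_right]

/-- covariant coordinates of `0`. [folklore] -/
theorem covOf_zero : covOf 0 = 0 := by
  funext i; simp [covOf]

/-! ## finite support -/

section FS
variable {w : Label → E3}

/-- covariant coordinates vanish off the support. [folklore] -/
theorem cov_eq_zero_of {ℓ : Label} (h : w ℓ = 0) : cov w ℓ = 0 := by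
  simp [cov, h, covOf_zero]

/-- `k ↦ bil M (w̃(m,k)) (w̃(m',k+n))` is finitely supported when `w` is. -/
theorem hasFiniteSupport_entry (hw : (support w).Finite) (M : Mat) (m m' : Fin 2) (n : Fin 3 → ℤ) :
    (fun k : Fin 3 → ℤ => bil M (cov w (m, k)) (cov w (m', k + n))).HasFiniteSupport := by
  have hw' : w.HasFiniteSupport := hw
  have h2 : (fun k : Fin 3 → ℤ => w (m, k)).HasFiniteSupport :=
    hw'.fun_comp_of_injective (g := fun k : Fin 3 → ℤ => ((m, k) : Label)) (Prod.mk_right_injective _)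
  refine (h2.subset ?_)
  intro k hk
  simp only [Function.mem_support, ne_eq] at hk ⊢
  intro h0
  apply hk
  simp [cov_eq_zero_of h0, bil]

/-- entries of a two-point table are summable on finitely supported fields. [folklore] -/
theorem summable_entry (hw : (support w).Finite) (M : Mat) (m m' : Fin 2) (n : Fin 3 → ℤ) :
    Summable (fun k : Fin 3 → ℤ => bil M (cov w (m, k)) (cov w (m', k + n))) :=
  summable_of_hasFiniteSupport (hasFiniteSupport_entry hw M m m' n)

end FS

/-! ## table evaluation lemmas -/

/-- evaluation of the empty table. [folklore] -/
@[simp] theorem tpEval_nil (w : Label → E3) : tpEval [] w = 0 := rfl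

/-- evaluation of a cons. [folklore] -/
@[simp] theorem tpEval_cons (e : BondClass × Mat) (T : TPTable) (w : Label → E3) :
    tpEval (e :: T) w = tpEntry w e + tpEval T w := by
  simp [tpEval]

/-- evaluation is additive under concatenation. [folklore] -/
theorem tpEval_append (S T : TPTable) (w : Label → E3) : tpEval (S ++ T) w = tpEval S w + tpEval T w := by
  simp [tpEval, List.map_append, List.sum_append]

/-- Flipping an entry does not change its evaluation (re-index `k ↦ k + n`). -/
theorem tpEntry_flip (w : Label → E3) (e : BondClass × Mat) : tpEntry w (flipEntry e) = tpEntry w e := by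
  obtain ⟨⟨m, m', n⟩, M⟩ := e
  simp only [tpEntry, flipEntry]
  have h1 : ∀ k : Fin 3 → ℤ, bil (fun i j => M j i) (cov w (m', k)) (cov w (m, k + -n)) =
      bil M (cov w (m, k + -n)) (cov w (m', k)) := fun k => bil_transpose M _ _
  simp only [h1]
  rw [← (Equiv.addRight n).tsum_eq (fun k => bil M (cov w (m, k + -n)) (cov w (m', k)))]
  refine tsum_congr fun k => ?_
  simp only [Equiv.coe_addRight]
  have hk : k + n + -n = k := by abel
  rw [hk]

/-- `mat9` is the identity. [folklore] -/
theorem mat9_eq (Q : Mat) : mat9 Q = Q := by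
  funext i j
  fin_cases i <;> fin_cases j <;> rfl

/-- adding the matrices of two entries of the same class adds their evaluations. [folklore] -/
theorem tpEntry_add {w : Label → E3} (hw : (support w).Finite) (c : BondClass) (M N : Mat) :
    tpEntry w (c, fun i j => M i j + N i j) = tpEntry w (c, M) + tpEntry w (c, N) := by
  simp only [tpEntry, bil_add_left]
  exact (summable_entry hw M _ _ _).tsum_add (summable_entry hw N _ _ _)

/-- merging adjacent entries preserves evaluation. [folklore] -/
theorem tpEval_mergeAdj {w : Label → E3} (hw : (support w).Finite) (T : TPTable) :
    tpEval (mergeAdj T) w = tpEval T w := by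
  induction hn : T.length using Nat.strong_induction_on generalizing T with
  | _ n ih =>
    match T, hn with
    | [], _ => simp [mergeAdj]
    | [e], _ => simp [mergeAdj]
    | e :: f :: rest, hn => 
        rw [mergeAdj]
        split_ifs with h
        · rw [ih _ (by simp at hn ⊢; omega) _ rfl, tpEval_cons, tpEval_cons, tpEval_cons, mat9_eq]
          obtain ⟨ke, Me⟩ := e
          obtain ⟨kf, Mf⟩ := f
          simp only at h
          subst h
          rw [tpEntry_add hw]
          ring
        · rw [tpEval_cons, tpEval_cons, ih _ (by simp at hn ⊢; omega) _ rfl, tpEval_cons]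

/-- a permutation of a table has the same evaluation. [folklore] -/
theorem tpEval_perm {S T : TPTable} (h : S.Perm T) (w : Label → E3) : tpEval S w = tpEval T w := by
  unfold tpEval
  exact (h.map _).sum_eq

/-- orienting an entry does not change its evaluation. [folklore] -/
theorem tpEval_orient (w : Label → E3) (e : BondClass × Mat) : tpEntry w (orient e) = tpEntry w e := by
  unfold orient
  split_ifs
  · rfl
  · exact tpEntry_flip w e

/-- **Canonical form preserves evaluation.** -/
theorem tpEval_canon {w : Label → E3} (hw : (support w).Finite) (T : TPTable) :
    tpEval (canon T) w = tpEval T w := by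
  unfold canon
  rw [tpEval_mergeAdj hw, tpEval_perm (List.mergeSort_perm _ _)]
  unfold tpEval
  rw [List.map_map]
  congr 1
  exact List.map_congr_left fun e _ => tpEval_orient w e

/-- **Pair forms are two-point tables.** -/
theorem pairEval_eq_tpEval {w : Label → E3} (hw : (support w).Finite) (c : BondClass) (M : Mat) :
    pairEval c M w = tpEval (pairTable c M) w := by
  obtain ⟨m, m', n⟩ := c
  simp only [pairEval, pairTable, tpEval_cons, tpEval_nil, add_zero, tpEntry, covDiff, bondDiff, cov]
  have hx : ∀ k : Fin 3 → ℤ, covOf (w (m', k + n) - w (m, k)) = covOf (w (m', k + n)) - covOf (w (m, k)) :=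
    fun k => covOf_sub _ _
  simp only [hx, bil_sub_sub, bil_neg]
  have s1 := summable_entry hw M m m 0
  have s2 : Summable fun k : Fin 3 → ℤ => bil M (covOf (w (m', k + n))) (covOf (w (m', k + n))) := by
    have := summable_entry hw M m' m' 0
    simp only [add_zero, cov] at this
    exact (Equiv.addRight n).summable_iff.mpr this |>.congr (fun k => by simp)
  have s3 := summable_entry hw M m m' n
  have s4 : Summable fun k : Fin 3 → ℤ => bil M (covOf (w (m', k + n))) (covOf (w (m, k))) := by
    have := summable_entry hw (fun i j => M j i) m m' n
    simp only [cov, bil_transpose] at this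
    exact this
  simp only [cov, add_zero] at s1 s3
  rw [((s1.add s2).sub s3).tsum_sub s4, (s1.add s2).tsum_sub s3, s1.tsum_add s2]
  have e2 : ∑' k : Fin 3 → ℤ, bil M (covOf (w (m', k + n))) (covOf (w (m', k + n))) =
      ∑' k : Fin 3 → ℤ, bil M (covOf (w (m', k))) (covOf (w (m', k + 0))) := by
    rw [← (Equiv.addRight n).tsum_eq (fun k => bil M (covOf (w (m', k))) (covOf (w (m', k + 0))))]
    simp
  have e4 : ∑' k : Fin 3 → ℤ, bil M (covOf (w (m', k + n))) (covOf (w (m, k))) =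
      ∑' k : Fin 3 → ℤ, bil M (covOf (w (m', k))) (covOf (w (m, k + -n))) := by
    rw [← (Equiv.addRight n).tsum_eq (fun k => bil M (covOf (w (m', k))) (covOf (w (m, k + -n))))]
    simp
  rw [e2, e4, tsum_neg, tsum_neg,
    show (fun b : Fin 3 → ℤ => bil M (covOf (w (m, b))) (covOf (w (m', b + n)))) =
      (fun b => bil M (covOf (w (m, b))) (covOf (w (m', n + b)))) from funext fun b => by rw [add_comm b n],
    show (fun k : Fin 3 → ℤ => bil M (covOf (w (m', k))) (covOf (w (m, k + -n)))) =
      (fun k => bil M (covOf (w (m', k))) (covOf (w (m, -n + k)))) from funext fun k => by rw [add_comm k (-n)]]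
  ring

/-! ## A total key order (the lexicographic one, spelled out) and the canonical form built on it -/

/-- integer three-way comparison: `0` less, `1` equal, `2` greater -/
def cmp3 (a b : ℤ) : ℕ := if a < b then 0 else if a = b then 1 else 2

/-- explicit lexicographic order of classes on `(m, m', n₀, n₁, n₂)` (total; the one the data is sorted by) -/
def keyLE2 (a b : BondClass) : Bool :=
  match cmp3 a.1.val b.1.val with
  | 0 => true
  | 2 => false
  | _ => match cmp3 a.2.1.val b.2.1.val with
    | 0 => true
    | 2 => false
    | _ => match cmp3 (a.2.2 0) (b.2.2 0) with
      | 0 => true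
      | 2 => false
      | _ => match cmp3 (a.2.2 1) (b.2.2 1) with
        | 0 => true
        | 2 => false
        | _ => decide (a.2.2 2 ≤ b.2.2 2)

/-- Orient an entry canonically (by the total order). -/
def orient2 (e : BondClass × Mat) : BondClass × Mat := if keyLE2 (flipEntry e).1 e.1 then e else flipEntry e

/-- Canonical form by the total order: orient, sort, merge equal classes (`O(n log n)`). -/
def canon2 (T : TPTable) : TPTable := mergeAdj ((T.map orient2).mergeSort fun a b => keyLE2 a.1 b.1)

/-- orienting by the total order does not change the evaluation. [folklore] -/
theorem tpEval_orient2 (w : Label → E3) (e : BondClass × Mat) : tpEntry w (orient2 e) = tpEntry w e := by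
  unfold orient2
  split_ifs
  · rfl
  · exact tpEntry_flip w e

/-- **Canonical form (total order) preserves evaluation.** -/
theorem tpEval_canon2 {w : Label → E3} (hw : (support w).Finite) (T : TPTable) :
    tpEval (canon2 T) w = tpEval T w := by
  unfold canon2
  rw [tpEval_mergeAdj hw, tpEval_perm (List.mergeSort_perm _ _)]
  unfold tpEval
  rw [List.map_map]
  congr 1
  exact List.map_congr_left fun e _ => tpEval_orient2 w e

/-- Anchor of this support file (registered stub of the line skeleton). -/
theorem stub_certTable : canon [] = [] := by simp [canon, mergeAdj]

end Summit.AtomisticToContinuum.Crystallization.Theorems.PhononStabilityCWC.Cert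

end
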